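import Summits.BirchSwinnertonDyer.BirchSwinnertonDyer.Theses.PrintX10b
import Summits.BirchSwinnertonDyer.BirchSwinnertonDyer.Theorems.PrintX10bHowardRoad
import Literature.NumberTheory.EllipticCurves.CastellaGrossiLeeSkinner2022.HowardDivisibilityAnyClassNumber
import HarnessLib

/-!
# Line `scalar-ks-shift-x10b` on crux stmt-BirchSwinnertonDyer-23729 `HowardContainmentAnyClassNumberX10b`
(route PrintX10b, r303 = A₃; registry crux decl
`Summit.BirchSwinnertonDyer.BirchSwinnertonDyer.Theses.PrintX10b.HowardContainmentAnyClassNumberX10b`).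

TRANSFER (lens «transfer», seat bsd-idea-5 g2) of a MACHINE rather than of a sibling skeleton: the EXACT
scalar-image Kolyvagin-system bound of Mastella–Zerman 2026 (arXiv:2505.08710: Lemma 2.39 — the
Čebotarev lemma needing only `E[p]` irreducible + scalars `1 + pℤ_p` in the `p`-adic image — Thm. 2.40
over a DVR and its `Λ^{ac}`-adic form Thm. 3.15: for a modified universal Kolyvagin system `κ^{ac}` with
`κ^{ac}(1) ≠ 0`, `Char(M) ∣ Char(H¹_𝓛(K,𝐓^{ac})/Λ^{ac}κ^{ac}(1))` WITH NO `p`-POWER AMBIGUITY) is applied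
not to Howard's classes over `K[p^{α+1}] ⊃ K_α` (where MZ26 Assumption 2.1 `p ∤ h_K` lives) but to the
`d(k)`-SHIFTED `α`-stabilised Heegner classes of Castella–Grossi–Lee–Skinner 2022 Thm. 4.1.1 / Rem. 4.1.4
(arXiv:2008.02571 §4.1: `P_k[n] ∈ E(K_k[n])`, `d(k) = min{d : K_k ⊂ K[p^d]}`, ANY class number; tree
`CastellaGrossiLeeSkinner2022.StabilizedHeegnerData`, `stabilizedHeegnerCharIdeal`). CGLS feed that Euler
system into their IMAGE-FREE Kolyvagin machine (Thm. 3.4.1), which is why their Thm. 4.1.3 is only a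
divisibility in `Λ[1/p, 1/(γ-1)]`; on X10b the image is small but SCALAR-RICH (Lombardo–Tronto Prop. 3.12:
the `3`-adic image of an irreducible non-surjective `ρ̄_{E,3}` contains `ℤ₃ˣ`; kernel theorem
`ClassX10.hasPadicScalarImage_of_not_surj`), so MZ26's exact machine applies to CGLS's any-class-number
system: the output is the INTEGRAL divisibility `char_Λ(X_tors) ∣ I(Λκ₁^{Hg})²` at every class number —
no `μ`-input, no torsion-depth case split (the two non-transferring steps of g0's line `torsion-depth-x10b`).

STUBS (3, the ONLY sorries; rev 2 2026-08-28 answers critic V#9 (P3)/(P4)):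
* `stub_scalarKS_shiftedDivisibility` — MZ26 Cor. 4.6 VERBATIM IN SHAPE (`cor46_howardDivisibility_of_
  scalarImage`: `𝐒` f.g. torsion-free of rank one, `X` of rank one, `char(X_tors) ∣ I²`) with Assumption
  2.1 (iii) `p ∤ h_K` DELETED and the tree Heegner family replaced by CGLS's stabilized datum `C`
  (`I = stabilizedHeegnerCharIdeal D C`). The NATURAL THEOREM (all odd `p`, all scalar-image curves);
  beyond print BY NAME (size XL): the research statement of the line.
* `stub_scalarKS_shiftedDivisibility_X10b` — its CRUX-BINDER SPECIALISATION (V#9 (P3): `p = 3` via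
  `ClassX10 W p`, `¬ Surj W 3`, `¬ CM`, `N = N_E`, X10b frame binders) keeping only the DIVISIBILITY
  conjunct (V#9 (P4): the crux consumes neither the rank nor the torsion-freeness conjunct, so no
  `NoZeroSMulDivisors Λ 𝐒` is owed); implied by the general stub IN THE KERNEL
  (`shiftedDivisibility_X10b_of_general`); a `p = 3`-only argument may close it directly.
* `stub_familyLeStabilized` — the module comparison `I(ℋ_F) ⊆ I(Λκ₁^{Hg})` for SOME stabilized datum `C`
  (tree family module `ℋ_F ⊆ Λκ₁^{Hg}` by the vertical distribution relations; also existence of `C`: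
  `d(k)` via `K_∞ ⊂ K[p^∞]`). REGISTERED here verbatim as g0's unregistered interior lemma
  `TorsionDepthX10b.Stmt.cmp_familyLeStabilized` (critic idea-crit-10 verdict #7 (P2): "first prover
  target"); size M.
Composition `HowardContainmentAnyClassNumberX10b_of : stub_X10b → stub_familyLe → crux` is sorry-free and
has NO case split: realise `jbar := IsAlgClosed.lift` along `ιC`, produce `(D, F, X)`
(`nonempty_lambdaAdicSelmerData`, `nonempty_heegnerFamily_of`, `nonempty_selmerDualData_holds`), take `C`
from the comparison and chain `I(ℋ_F)² ⊆ I(Λκ₁^{Hg})² ⊆ char(X_tors)`;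
`HowardContainmentAnyClassNumberX10b_of_general : stub_general → stub_familyLe → crux` derives MZ26's
class-number-free hypotheses from the X10b binders IN THE KERNEL (`ClassX10.irr /
hasPadicScalarImage_of_not_surj / ne_two / not_dvd_conductorNorm / isOrdinaryAt`, `not_dvd_discr_of_split`).
Kernel evidence `treeFamilyDivisibility_coprime_of_cor46`: at `p ∤ h_K` the general stub's conclusion for
the TREE family is MZ26 Cor. 4.6 by name (so the stub's only new content is the class-number deletion +
the stabilized currency). BSD is not proved by any of this.
-/

set_option linter.dupNamespace false
set_option autoImplicit false

noncomputable section

open scoped Classical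

namespace Summit.BirchSwinnertonDyer.BirchSwinnertonDyer.Cruxes.HowardContainmentAnyClassNumberX10b.ScalarKsShiftX10b

open WeierstrassCurve NumberField IsDedekindDomain Field Literature.NumberTheory.EllipticCurves
  Literature.NumberTheory.EllipticCurves.ModularForms
open Literature.NumberTheory.EllipticCurves.Rank1Residual (ClassX10 Surj not_dvd_discr_of_split)

/-! ## Stub statements as named propositions -/

/-- **MZ26 Cor. 4.6 at ANY class number, in CGLS's stabilized currency** (the research statement of the
line): for `E/ℚ` non-CM with `E[p]` irreducible and scalars `1 + pℤ_p` in the `p`-adic image, `p` odd of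
good ordinary reduction, `p ∤ N·d_K`, `K` imaginary quadratic with `d_K ∉ {-3,-4}` and Heegner for `N`,
`κ` anticyclotomic with generator `γ` — and NO hypothesis on `h_K` — `𝐒 = H¹_{𝓛_Gr}(K,𝐓^{ac})` is f.g.
torsion-free of `Λ`-rank one, `X` has `Λ`-rank one and `char_Λ(X_{Λ-tors}) ∣ I(Λκ₁^{Hg})²`, where
`Λκ₁^{Hg}` is the module of CGLS's `d(k)`-shifted stabilized class (`stabilizedHeegnerCharIdeal D C`).
Binders = the fields of `MastellaZerman2026.Hypotheses` minus `not_dvd_classNumber`, letter for letter;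
conclusion = the body of `MastellaZerman2026.cor46_howardDivisibility_of_scalarImage` with `F ↦ C`.
Mechanism: MZ26 Thm. 3.15 (exact, scalar-image) applied to the Kolyvagin system of CGLS Thm. 4.1.1
(any class number), `κ₁ ≠ 0` by Cornut–Vatsal.
[cite: MastellaZerman2026, Thm. 3.15, Thm. 2.40, Lemma 2.39, Cor. 4.6, Assumption 2.1 (arXiv:2505.08710)]
[cite: CastellaGrossiLeeSkinner2022, Thm. 4.1.1, Rem. 4.1.4, Thm. 4.1.3 (arXiv:2008.02571 §4.1)]
[cite: LombardoTronto2022, Prop. 3.12] -/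
def Stmt.stub_scalarKS_shiftedDivisibility : Prop :=
    ∀ (N : ℕ) [NeZero N] (W : WeierstrassCurve ℚ) [W.IsElliptic] [W.IsGloballyMinimal]
      (K : Type) [Field K] [NumberField K] (p : ℕ) [Fact p.Prime] (κ : ZpExtension K p)
      (γ : Field.absoluteGaloisGroup K) (jbar : AlgebraicClosure K →+* ℂ),
      ¬ W.HasCM → W.HasIrreducibleModPGaloisRep p → MastellaZerman2026.HasPadicScalarImage W p →
      IsImaginaryQuadratic K → NumberField.discr K ≠ -3 → NumberField.discr K ≠ -4 →
      SatisfiesHeegnerHypothesis N K → p ≠ 2 → ¬ p ∣ N → ¬ (p : ℤ) ∣ NumberField.discr K →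
      IsOrdinaryAt W p → κ.IsAnticyclotomic → κ.IsTopGenerator γ →
      ∀ (D : (W.baseChange K).LambdaAdicSelmerData κ γ)
        (C : CastellaGrossiLeeSkinner2022.StabilizedHeegnerData N W K κ jbar)
        (X : (W.baseChange K).SelmerDualData κ γ),
        (Module.Finite (IwasawaAlgebra p) D.S ∧ NoZeroSMulDivisors (IwasawaAlgebra p) D.S ∧
            Module.finrank (IwasawaAlgebra p) D.S = 1) ∧
          (Module.Finite (IwasawaAlgebra p) X.X ∧ Module.finrank (IwasawaAlgebra p) X.X = 1 ∧
            Module.charIdeal (IwasawaAlgebra p) (Submodule.torsion (IwasawaAlgebra p) X.X) ∣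
              CastellaGrossiLeeSkinner2022.stabilizedHeegnerCharIdeal D C ^ 2)

/-- **The module comparison + existence of the shifted datum** (g0's interior lemma
`TorsionDepthX10b.Stmt.cmp_familyLeStabilized`, VERBATIM, now a registered stub): for every `Λ`-adic
Selmer datum `D` and every tree Heegner family `F` at level `N_E` on an X10b frame there is a CGLS
`d(k)`-shifted datum `C` (same `π`, same `𝔑`; `d(k)` from `K_∞ ⊂ K[3^∞]`) with `I(ℋ_F) ⊆ I(Λκ₁^{Hg})` —
`z_j = Norm_{K_jK[3^{j+1}]/K_j} P[3^{j+1}] = a_3·u_j - v_j` above the torsion depth (vertical distribution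
relations), so `ℋ_F ⊆ Λκ₁^{Hg}` and `char(𝐒/ℋ_F) ⊆ char(𝐒/Λκ₁^{Hg})`.
[cite: CastellaGrossiLeeSkinner2022, Thm. 4.1.1 proof (d(k)), Rem. 4.1.4]
[cite: PerrinRiou1987BSMF, §3.3 (distribution relations)] -/
def Stmt.stub_familyLeStabilized : Prop :=
    ∀ (W : WeierstrassCurve ℚ) [W.IsElliptic] [W.IsGloballyMinimal] (p : ℕ) [Fact p.Prime]
      [NeZero (W.conductorNorm ℤ)] (K : Type) [Field K] [NumberField K],
      ClassX10 W p → IsImaginaryQuadratic K →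
      SatisfiesHeegnerHypothesis (W.conductorNorm ℤ) K → SatisfiesHeegnerHypothesis p K →
      ∀ (κ : ZpExtension K p), κ.IsAnticyclotomic → ∀ (γ : Field.absoluteGaloisGroup K),
      κ.IsTopGenerator γ →
      ∀ (jbar : AlgebraicClosure K →+* ℂ) (D : (W.baseChange K).LambdaAdicSelmerData κ γ)
        (F : HeegnerFamily (W.conductorNorm ℤ) W K κ jbar),
      ∃ C : CastellaGrossiLeeSkinner2022.StabilizedHeegnerData (W.conductorNorm ℤ) W K κ jbar,
        heegnerCharIdeal D F ≤ CastellaGrossiLeeSkinner2022.stabilizedHeegnerCharIdeal D C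

/-- **The crux-binder specialisation of `Stmt.stub_scalarKS_shiftedDivisibility`** (critic V#9 (P3): a
named corollary target so that a `p = 3`-only argument can close the crux without the general statement;
(P4): only the DIVISIBILITY conjunct is kept — the rank / torsion-freeness conjuncts of MZ26 Cor. 4.6 are
not consumed by the crux). Binders = the crux's (`ClassX10 W p`, `¬ Surj W 3`, `¬ CM`, `K` imaginary
quadratic with `d_K ∉ {-3,-4}`, Heegner for `N_E` and for `p`, `κ` anticyclotomic with generator `γ`),
level `N = N_E`; conclusion `char_Λ(X_tors) ∣ I(Λκ₁^{Hg})²` for every CGLS shifted datum `C`. Implied by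
the general stub (kernel: `shiftedDivisibility_X10b_of_general`).
[cite: MastellaZerman2026, Thm. 3.15, Cor. 4.6 (arXiv:2505.08710)]
[cite: CastellaGrossiLeeSkinner2022, Thm. 4.1.1, Rem. 4.1.4 (arXiv:2008.02571 §4.1)] -/
def Stmt.stub_scalarKS_shiftedDivisibility_X10b : Prop :=
    ∀ (W : WeierstrassCurve ℚ) [W.IsElliptic] [W.IsGloballyMinimal] (p : ℕ) [Fact p.Prime]
      [NeZero (W.conductorNorm ℤ)] (K : Type) [Field K] [NumberField K],
      ClassX10 W p → ¬ Surj W 3 → ¬ W.HasCM → IsImaginaryQuadratic K →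
      NumberField.discr K ≠ -3 → NumberField.discr K ≠ -4 →
      SatisfiesHeegnerHypothesis (W.conductorNorm ℤ) K → SatisfiesHeegnerHypothesis p K →
      ∀ (κ : ZpExtension K p), κ.IsAnticyclotomic → ∀ (γ : Field.absoluteGaloisGroup K),
      κ.IsTopGenerator γ →
      ∀ (jbar : AlgebraicClosure K →+* ℂ) (D : (W.baseChange K).LambdaAdicSelmerData κ γ)
        (C : CastellaGrossiLeeSkinner2022.StabilizedHeegnerData (W.conductorNorm ℤ) W K κ jbar)
        (X : (W.baseChange K).SelmerDualData κ γ),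
        Module.charIdeal (IwasawaAlgebra p) (Submodule.torsion (IwasawaAlgebra p) X.X) ∣
          CastellaGrossiLeeSkinner2022.stabilizedHeegnerCharIdeal D C ^ 2

/-! ## The stubs (the ONLY sorries of the file) -/

theorem stub_scalarKS_shiftedDivisibility : Stmt.stub_scalarKS_shiftedDivisibility := by
  sorry

theorem stub_familyLeStabilized : Stmt.stub_familyLeStabilized := by
  sorry

theorem stub_scalarKS_shiftedDivisibility_X10b : Stmt.stub_scalarKS_shiftedDivisibility_X10b := by
  sorry

/-! ## Composition (kernel-checked, no `sorry`, no case split) -/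

/-- **General ⇒ special** (kernel): MZ26's class-number-free hypotheses follow from the X10b binders —
`ClassX10.irr / hasPadicScalarImage_of_not_surj` (Lombardo–Tronto Prop. 3.12, a theorem) `/ ne_two /
not_dvd_conductorNorm / isOrdinaryAt`, `not_dvd_discr_of_split`. -/
theorem shiftedDivisibility_X10b_of_general (h₁ : Stmt.stub_scalarKS_shiftedDivisibility) :
    Stmt.stub_scalarKS_shiftedDivisibility_X10b := by
  unfold Stmt.stub_scalarKS_shiftedDivisibility at h₁
  intro W _ _ p _ _ K _ _ hX hns hcm hK h3 h4 hHN hHp κ hκ γ hγ jbar D C X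
  exact (h₁ (W.conductorNorm ℤ) W K p κ γ jbar hcm hX.irr (hX.hasPadicScalarImage_of_not_surj hns) hK h3
    h4 hHN hX.ne_two hX.not_dvd_conductorNorm (not_dvd_discr_of_split hK Fact.out hX.ne_two hHp)
    hX.isOrdinaryAt hκ hγ D C X).2.2.2

/-- **The specialised divisibility and the comparison give the crux BY NAME.** Realise
`jbar := IsAlgClosed.lift` along `ιC`, produce the data, take the stabilized datum from the comparison,
and chain `I(ℋ_F)² ⊆ I(Λκ₁^{Hg})² ⊆ char(X_tors)`. -/
theorem HowardContainmentAnyClassNumberX10b_of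
    (h₁ : Stmt.stub_scalarKS_shiftedDivisibility_X10b) (h₂ : Stmt.stub_familyLeStabilized) :
    Summit.BirchSwinnertonDyer.BirchSwinnertonDyer.Theses.PrintX10b.HowardContainmentAnyClassNumberX10b := by
  unfold Stmt.stub_scalarKS_shiftedDivisibility_X10b at h₁
  unfold Stmt.stub_familyLeStabilized at h₂
  intro W _ _ p _ _ K _ _ hX hns hcm hK h3 h4 hHN hHp κ hκ γ hγ Dt H ιC
  letI : Algebra K ℂ := ιC.toAlgebra
  let jbar : AlgebraicClosure K →+* ℂ :=
    (IsAlgClosed.lift (R := K) (M := ℂ) (S := AlgebraicClosure K)).toRingHom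
  obtain ⟨D⟩ := LambdaAdicSelmerDataExists.nonempty_lambdaAdicSelmerData (W.baseChange K) p κ hγ
  obtain ⟨X⟩ := (W.baseChange K).nonempty_selmerDualData_holds κ γ hγ
  obtain ⟨F⟩ := nonempty_heegnerFamily_of (exists_isHeegnerNormPoint_holds (W.conductorNorm ℤ) W K p)
    hK hHN hX.not_dvd_conductorNorm κ Dt H.dvd_sq_sub jbar
  obtain ⟨C, hFC⟩ := h₂ W p K hX hK hHN hHp κ hκ γ hγ jbar D F
  have hdvd := h₁ W p K hX hns hcm hK h3 h4 hHN hHp κ hκ γ hγ jbar D C X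
  exact ⟨jbar, D, F, X, le_trans (Ideal.pow_right_mono hFC 2) (Ideal.le_of_dvd hdvd)⟩

/-- The crux from the GENERAL (natural-theorem) stub and the comparison. -/
theorem HowardContainmentAnyClassNumberX10b_of_general
    (h₁ : Stmt.stub_scalarKS_shiftedDivisibility) (h₂ : Stmt.stub_familyLeStabilized) :
    Summit.BirchSwinnertonDyer.BirchSwinnertonDyer.Theses.PrintX10b.HowardContainmentAnyClassNumberX10b :=
  HowardContainmentAnyClassNumberX10b_of (shiftedDivisibility_X10b_of_general h₁) h₂

/-- The composed line from the stubs (sorries only through `stub_*`). -/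
theorem HowardContainmentAnyClassNumberX10b_of_stubs :
    Summit.BirchSwinnertonDyer.BirchSwinnertonDyer.Theses.PrintX10b.HowardContainmentAnyClassNumberX10b :=
  HowardContainmentAnyClassNumberX10b_of stub_scalarKS_shiftedDivisibility_X10b stub_familyLeStabilized

/-! ## Kernel evidence for the transfer -/

/-- **What the first stub adds to print is exactly the class-number deletion and the stabilized currency:**
at `p ∤ h_K` its conclusion for the TREE family is MZ26 Cor. 4.6 by name.
[cite: MastellaZerman2026, Cor. 4.6] -/
theorem treeFamilyDivisibility_coprime_of_cor46
    (h46 : MastellaZerman2026.cor46_howardDivisibility_of_scalarImage.{0})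
    (N : ℕ) [NeZero N] (W : WeierstrassCurve ℚ) [W.IsElliptic] [W.IsGloballyMinimal]
    (K : Type) [Field K] [NumberField K] (p : ℕ) [Fact p.Prime] (κ : ZpExtension K p)
    (γ : Field.absoluteGaloisGroup K) (jbar : AlgebraicClosure K →+* ℂ)
    (hcm : ¬ W.HasCM) (hirr : W.HasIrreducibleModPGaloisRep p)
    (hsc : MastellaZerman2026.HasPadicScalarImage W p) (hK : IsImaginaryQuadratic K)
    (h3 : NumberField.discr K ≠ -3) (h4 : NumberField.discr K ≠ -4) (hHN : SatisfiesHeegnerHypothesis N K)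
    (hp2 : p ≠ 2) (hpN : ¬ p ∣ N) (hpd : ¬ (p : ℤ) ∣ NumberField.discr K) (hord : IsOrdinaryAt W p)
    (hκ : κ.IsAnticyclotomic) (hγ : κ.IsTopGenerator γ) (hh : ¬ p ∣ NumberField.classNumber K)
    (D : (W.baseChange K).LambdaAdicSelmerData κ γ) (F : HeegnerFamily N W K κ jbar)
    (X : (W.baseChange K).SelmerDualData κ γ) :
    Module.charIdeal (IwasawaAlgebra p) (Submodule.torsion (IwasawaAlgebra p) X.X) ∣
      heegnerCharIdeal D F ^ 2 :=
  (h46 N W K p κ γ jbar ⟨inferInstance, hcm, hirr, hsc, hK, ⟨h3, h4⟩, hHN, hp2, hpN, hpd, hh, hord, hκ, hγ⟩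
    D F X).2.2.2

/-- **The stabilized-currency conclusion dominates the crux's tree-family containment** (the order of the
two inclusions used by the composition, isolated): `I(ℋ_F) ⊆ I(Λκ₁^{Hg})` and `char ∣ I(Λκ₁^{Hg})²` give
`I(ℋ_F)² ⊆ char`. [cite: CastellaGrossiLeeSkinner2022, Rem. 4.1.4] -/
theorem family_sq_le_of_stabilized {p : ℕ} [Fact p.Prime] {I J c : Ideal (IwasawaAlgebra p)}
    (hIJ : I ≤ J) (hc : c ∣ J ^ 2) : I ^ 2 ≤ c :=
  le_trans (Ideal.pow_right_mono hIJ 2) (Ideal.le_of_dvd hc)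

end Summit.BirchSwinnertonDyer.BirchSwinnertonDyer.Cruxes.HowardContainmentAnyClassNumberX10b.ScalarKsShiftX10b

end
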